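import Literature.AlgebraicGeometry.Modules.CechUnitModulePairing
import Literature.Algebra.Homology.OrderedCechSystemAlternating
import HarnessLib

/-!
# The pull-back of structure-sheaf sections along a scheme morphism, as a morphism of module Čech systems

Layer `Literature/AlgebraicGeometry/Modules` (DEFINITIONS `pullbackSecMod`, `pullbackSystemHom` + their equation lemmas;
no instance, no notation, no attribute games); cell `hodgecm-mathlib`, F-11 sub-line P1b, brick (G5-d) of the product-cover
bookkeeping (B-p21 (g21); letter F0P1b-p02 (g2) `LETTER-G5-ProductCover.v0` §(G5-d); DEF #14 of F0P1b-plan's book).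

For a morphism of schemes `f : Y ⟶ X`, families of opens `U : ι → X.Opens`, `V : ι' → Y.Opens`, an index map
`θ : ι' → ι` which is ADMISSIBLE (`V c ⊆ f⁻¹ U (θ c)` for all `c`), and base-ring structures `ρX : A → Γ(X)`,
`ρY : A → Γ(Y)` with `ρY = f^* ∘ ρX`, the pull-back of functions `f^*|` is an `A`-linear map
`Γ(𝒪_X, U_{θ(s')}) → Γ(𝒪_Y, V_{s'})` for every finite set of indices `s'` (★ `Modules.sectionsSystem` of the structure
sheaf `unitModule`), natural in `s'`: a morphism of systems
`pullbackSystemHom : OrderedCech.imageFunctor θ ⋙ sectionsSystem U (unitModule X) ρX ⟶ sectionsSystem V (unitModule Y) ρY`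
— exactly the datum `φ` along which ★ `OrderedCech.refineCochain θ φ` refines ordered Čech cochains (the cochain-level
`f^♯ : Č•(𝓤, 𝒪_X) → Č•(𝓥, 𝒪_Y)`, [StacksProject, Tag 01FG]; [Godement1958, II §5.8]).

* §1 `preimage_finsetInf`, `cechOpen_le_preimage_cechOpen_image` — `V_{s'} ⊆ f⁻¹ U_{θ(s')}`;
* §2 `pullbackSecMod` (one finite set of indices) with `toRing_pullbackSecMod` (it is `f.appLE` on functions),
  `pullbackSecMod_res` (compatible with restriction);
* §3 **`pullbackSystemHom`** with `toRing_pullbackSystemHom_app`; it is MULTIPLICATIVE for ★ `mulPairing`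
  (`pullbackSystemHom_mulPairing`, ring maps) and UNITAL (`pullbackSystemHom_unitFamily`); composition and identity at
  the level of underlying functions (`toRing_pullbackSystemHom_comp`, `toRing_pullbackSystemHom_id`; the functor identity
  `imageFunctor (θ ∘ θ') = imageFunctor θ' ⋙ imageFunctor θ` is only propositional, so no `whisker` equation is stated).

HC_CM is proved only modulo the 7 printed citations until rung 0 closes — nothing here bears on a summit statement.

## References
* [StacksProject] The Stacks Project, Tag 01FG (Čech complex, refinement along a map of coverings; functoriality).
* [Godement1958] R. Godement, *Topologie algébrique et théorie des faisceaux* (1958), II §5.8.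
* [GortzWedhorn2023] U. Görtz, T. Wedhorn, *Algebraic Geometry II* (2023), Def. 21.68 (p. 180).
-/

noncomputable section

universe u

-- `TopCat.Presheaf`/`TopCat.Sheaf` are not reducible (as in Mathlib's `AlgebraicGeometry/Modules`).
set_option backward.isDefEq.respectTransparency false

open CategoryTheory AlgebraicGeometry TopologicalSpace Opposite
open Literature.Algebra.Homology Literature.Algebra.Homology.OrderedCech

namespace Literature.AlgebraicGeometry.Modules

variable {X Y : Scheme.{u}} (f : Y ⟶ X) {ι ι' : Type} [LinearOrder ι] (U : ι → X.Opens) (V : ι' → Y.Opens) (θ : ι' → ι)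
  (hθ : ∀ c, V c ≤ f ⁻¹ᵁ U (θ c)) {A : Type u} [CommRing A] (ρX : A →+* Γ(X, ⊤)) (ρY : A →+* Γ(Y, ⊤))
  (hρ : ∀ a, ρY a = f.appTop (ρX a))

/-! ## §1 The admissible index map on finite sets of indices -/

omit [LinearOrder ι] in
/-- Preimages commute with finite intersections of opens. [cite: GortzWedhorn2023, Def. 21.68 (p. 180)] -/
theorem preimage_finsetInf (t : Finset ι) : f ⁻¹ᵁ t.inf U = t.inf fun i => f ⁻¹ᵁ U i := by
  classical
  induction t using Finset.induction_on with
  | empty => rfl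
  | insert a t ha ih => rw [Finset.inf_insert, Finset.inf_insert, Scheme.Hom.preimage_inf, ih]

include hθ in
/-- **`V_{s'} ⊆ f⁻¹ U_{θ(s')}`**: an admissible index map is admissible on every finite set of indices.
[cite: StacksProject, Tag 01FG] -/
theorem cechOpen_le_preimage_cechOpen_image (s' : Finset ι') :
    cechOpen V s' ≤ f ⁻¹ᵁ cechOpen U (s'.image θ) := by
  unfold cechOpen
  rw [preimage_finsetInf, Finset.inf_image]
  exact Finset.inf_mono_fun fun c _ => hθ c

/-! ## §2 The pull-back of functions over one finite set of indices -/

omit [LinearOrder ι] in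
include hρ in
/-- `f^*` carries the `A`-structure constants of `X` to those of `Y`: `f^*(ρX(a)|_W) = ρY(a)|_{W'}`.
[cite: GortzWedhorn2023, Def. 21.68 (p. 180)] -/
theorem appLE_toSections {W : X.Opens} {W' : Y.Opens} (h : W' ≤ f ⁻¹ᵁ W) (a : A) :
    f.appLE W W' h (toSections ρX W a) = toSections ρY W' a := by
  change (X.presheaf.map (homOfLE le_top).op ≫ f.appLE W W' h) (ρX a) =
    (Y.presheaf.map (homOfLE le_top).op) (ρY a)
  rw [Scheme.Hom.map_appLE, hρ]
  change _ = (f.appTop ≫ Y.presheaf.map (homOfLE le_top).op) (ρX a)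
  rw [Scheme.Hom.appTop, Scheme.Hom.app_eq_appLE, Scheme.Hom.appLE_map]

/-- **The pull-back of functions `Γ(𝒪_X, U_{θ(s')}) → Γ(𝒪_Y, V_{s'})`** as an `A`-linear map (it is `f.appLE`; `A`-linear
because `ρY = f^* ∘ ρX`). [cite: StacksProject, Tag 01FG] -/
def pullbackSecMod (s' : Finset ι') :
    SecMod (unitModule X) ρX (cechOpen U (s'.image θ)) →ₗ[A] SecMod (unitModule Y) ρY (cechOpen V s') where
  toFun x := SecMod.ofRing ρY (f.appLE (cechOpen U (s'.image θ)) (cechOpen V s')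
    (cechOpen_le_preimage_cechOpen_image f U V θ hθ s') (SecMod.toRing ρX x))
  map_add' x y := by
    apply SecMod.toRing_injective ρY
    rw [SecMod.toRing_ofRing, SecMod.toRing_add, SecMod.toRing_add, map_add, SecMod.toRing_ofRing,
      SecMod.toRing_ofRing]
  map_smul' a x := by
    apply SecMod.toRing_injective ρY
    rw [SecMod.toRing_ofRing, SecMod.toRing_smul, map_mul, RingHom.id_apply, SecMod.toRing_smul,
      SecMod.toRing_ofRing, appLE_toSections f ρX ρY hρ]

/-- `pullbackSecMod` on underlying functions is `f.appLE`. [cite: StacksProject, Tag 01FG] -/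
theorem toRing_pullbackSecMod (s' : Finset ι') (x : SecMod (unitModule X) ρX (cechOpen U (s'.image θ))) :
    SecMod.toRing ρY (pullbackSecMod f U V θ hθ ρX ρY hρ s' x) =
      f.appLE (cechOpen U (s'.image θ)) (cechOpen V s')
        (cechOpen_le_preimage_cechOpen_image f U V θ hθ s') (SecMod.toRing ρX x) := rfl

/-- **Compatibility with restriction**: for `s' ⊆ t'`, `res ∘ f^*|_{s'} = f^*|_{t'} ∘ res`.
[cite: StacksProject, Tag 01FG] -/
theorem pullbackSecMod_res {s' t' : Finset ι'} (h : s' ⊆ t') (x : SecMod (unitModule X) ρX (cechOpen U (s'.image θ))) :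
    SecMod.res (unitModule Y) ρY (cechOpen_anti V h) (pullbackSecMod f U V θ hθ ρX ρY hρ s' x) =
      pullbackSecMod f U V θ hθ ρX ρY hρ t'
        (SecMod.res (unitModule X) ρX (cechOpen_anti U (Finset.image_subset_image h)) x) := by
  apply SecMod.toRing_injective ρY
  rw [SecMod.toRing_res, toRing_pullbackSecMod, toRing_pullbackSecMod, SecMod.toRing_res]
  change (f.appLE _ _ _ ≫ Y.presheaf.map (homOfLE _).op) _ = (X.presheaf.map (homOfLE _).op ≫ f.appLE _ _ _) _
  rw [Scheme.Hom.appLE_map, Scheme.Hom.map_appLE]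

/-! ## §3 The morphism of systems -/

/-- **THE PULL-BACK AS A MORPHISM OF MODULE ČECH SYSTEMS** `φ_{s'} : Γ(𝒪_X, U_{θ(s')}) → Γ(𝒪_Y, V_{s'})` along the
admissible index map `θ` (the datum of ★ `OrderedCech.refineCochain θ φ`). [cite: StacksProject, Tag 01FG] -/
def pullbackSystemHom : imageFunctor θ ⋙ sectionsSystem U (unitModule X) ρX ⟶ sectionsSystem V (unitModule Y) ρY where
  app s' := ModuleCat.ofHom (pullbackSecMod f U V θ hθ ρX ρY hρ s')
  naturality s' t' h := by
    ext x
    change pullbackSecMod f U V θ hθ ρX ρY hρ t' (SecMod.res (unitModule X) ρX _ x) =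
      SecMod.res (unitModule Y) ρY _ (pullbackSecMod f U V θ hθ ρX ρY hρ s' x)
    rw [pullbackSecMod_res f U V θ hθ ρX ρY hρ h.le]
    rfl

/-- The components of `pullbackSystemHom` on underlying functions: `f.appLE`. [cite: StacksProject, Tag 01FG] -/
theorem toRing_pullbackSystemHom_app (s' : Finset ι') (x : SecMod (unitModule X) ρX (cechOpen U (s'.image θ))) :
    SecMod.toRing ρY (((pullbackSystemHom f U V θ hθ ρX ρY hρ).app s').hom x) =
      f.appLE (cechOpen U (s'.image θ)) (cechOpen V s')
        (cechOpen_le_preimage_cechOpen_image f U V θ hθ s') (SecMod.toRing ρX x) := rfl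

/-- **The pull-back is MULTIPLICATIVE** for the multiplication pairings ★ `mulPairing` of `𝒪_X` and `𝒪_Y` (the
components are ring maps): the hypothesis under which ★ `refineCochain_cup` transports cup products.
[cite: Godement1958, II §6.6] [cite: StacksProject, Tag 01FG] -/
theorem pullbackSystemHom_mulPairing (s' : Finset ι')
    (x y : (imageFunctor θ ⋙ sectionsSystem U (unitModule X) ρX).obj s') :
    ((pullbackSystemHom f U V θ hθ ρX ρY hρ).app s').hom (mulPairing U ρX (s'.image θ) x y) =
      mulPairing V ρY s' (((pullbackSystemHom f U V θ hθ ρX ρY hρ).app s').hom x)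
        (((pullbackSystemHom f U V θ hθ ρX ρY hρ).app s').hom y) := by
  apply SecMod.toRing_injective ρY
  rw [toRing_pullbackSystemHom_app, toRing_mulPairing, toRing_mulPairing, map_mul,
    toRing_pullbackSystemHom_app, toRing_pullbackSystemHom_app]

/-- **The pull-back is UNITAL**: it carries the unit sections to the unit sections. [cite: Godement1958, II §6.6] -/
theorem pullbackSystemHom_unitFamily (s' : Finset ι') :
    ((pullbackSystemHom f U V θ hθ ρX ρY hρ).app s').hom (unitFamily U ρX (s'.image θ)) = unitFamily V ρY s' := by
  apply SecMod.toRing_injective ρY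
  rw [toRing_pullbackSystemHom_app, toRing_unitFamily, toRing_unitFamily, map_one]

/-- **COMPOSITION on underlying functions**: for `g : Z ⟶ Y` with an admissible `θ' : ι'' → ι'` for the covers `V`, `W`,
the pull-back along `g ≫ f` with the composite index map `θ ∘ θ'` is `g^* ∘ f^*` on functions
(Mathlib `Scheme.Hom.appLE_comp_appLE`). [cite: StacksProject, Tag 01FG] -/
theorem toRing_pullbackSystemHom_comp [LinearOrder ι'] {Z : Scheme.{u}} (g : Z ⟶ Y) {ι'' : Type} (W : ι'' → Z.Opens)
    (θ' : ι'' → ι') (hθ' : ∀ d, W d ≤ g ⁻¹ᵁ V (θ' d)) (ρZ : A →+* Γ(Z, ⊤)) (hρ' : ∀ a, ρZ a = g.appTop (ρY a))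
    (hθθ' : ∀ d, W d ≤ (g ≫ f) ⁻¹ᵁ U ((θ ∘ θ') d)) (hρρ' : ∀ a, ρZ a = (g ≫ f).appTop (ρX a))
    (s'' : Finset ι'') (x : SecMod (unitModule X) ρX (cechOpen U (s''.image (θ ∘ θ'))))
    (x' : SecMod (unitModule X) ρX (cechOpen U ((s''.image θ').image θ)))
    (hx : SecMod.toRing ρX x' = X.presheaf.map (eqToHom (by rw [Finset.image_image])).op (SecMod.toRing ρX x)) :
    SecMod.toRing ρZ (((pullbackSystemHom (g ≫ f) U W (θ ∘ θ') hθθ' ρX ρZ hρρ').app s'').hom x) =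
      SecMod.toRing ρZ (((pullbackSystemHom g V W θ' hθ' ρY ρZ hρ').app s'').hom
        (((pullbackSystemHom f U V θ hθ ρX ρY hρ).app (s''.image θ')).hom x')) := by
  rw [toRing_pullbackSystemHom_app, toRing_pullbackSystemHom_app, toRing_pullbackSystemHom_app, hx]
  change _ = ((X.presheaf.map (eqToHom _).op ≫ f.appLE _ _ _) ≫ g.appLE _ _ _) (SecMod.toRing ρX x)
  rw [Scheme.Hom.map_appLE, Scheme.Hom.appLE_comp_appLE]

/-- **IDENTITY on underlying functions**: the pull-back along `𝟙 X` with an admissible index map `θ` between two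
covers of `X` is the RESTRICTION `Γ(U_{θ(s')}) → Γ(V_{s'})`. [cite: StacksProject, Tag 01FG] -/
theorem toRing_pullbackSystemHom_id (V₁ : ι' → X.Opens) (hθ₁ : ∀ c, V₁ c ≤ (𝟙 X : X ⟶ X) ⁻¹ᵁ U (θ c))
    (hρ₁ : ∀ a, ρX a = (𝟙 X : X ⟶ X).appTop (ρX a)) (s' : Finset ι')
    (x : SecMod (unitModule X) ρX (cechOpen U (s'.image θ))) :
    SecMod.toRing ρX (((pullbackSystemHom (𝟙 X) U V₁ θ hθ₁ ρX ρX hρ₁).app s').hom x) =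
      X.presheaf.map (homOfLE (cechOpen_le_preimage_cechOpen_image (𝟙 X) U V₁ θ hθ₁ s')).op (SecMod.toRing ρX x) := by
  rw [toRing_pullbackSystemHom_app, Scheme.Hom.appLE, Scheme.Hom.id_app, Category.id_comp]
  rfl

end Literature.AlgebraicGeometry.Modules

end
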